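import Summits.ResolutionOfSingularities.ResolutionOfSingularities.Theorems.FrobeniusLadderFRationalResolutionEtaleChartPrimaryCentreAlgClosed
import Summits.ResolutionOfSingularities.ResolutionOfSingularities.Theorems.FrobeniusLadderFRationalResolutionIsolatedQuotientResolutionField
import Mathlib.FieldTheory.PurelyInseparable.Basic
import Mathlib.RingTheory.Unramified.Field
import HarnessLib

/-!
# Crux `FrobeniusLadder.FRationalResolution` (stmt-ResolutionOfSingularities-15317), line `redirect`,
# stub `stub_diagonalizableQuotientResolution` — over a SEPARABLY CLOSED ground field the residue condition of brick E-k
# is automatic; ISOLATED diagonalizable quotient singularities over `K = K^sep` are resolvable (tame or wild, any dimension)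

`…EtaleChartPrimaryCentreAlgClosed.stalkMap_residue_surjective_of_isAlgClosed` (✓ p824253 era) discharges E-k's residue
condition `κ(φ y) = κ(y)` over an ALGEBRAICALLY closed `K` (the residue field of a closed point IS `K`). The honest
mechanism is finer and needs only `K` SEPARABLY closed (e.g. an imperfect `K = K^sep` of characteristic `p`, where
`κ(x) ⊋ K` is possible): for an étale `φ : Y → X` and a closed point `x = φ y` of `X` locally of finite type over `K`,
`κ(y) / κ(x)` is finite SEPARABLE (`Algebra.FormallyUnramified.isSeparable`), while `κ(x)` is finite over `K`
(Zariski's lemma, `finite_of_finite_type_of_isJacobsonRing`) hence separably closed (`Algebra.IsAlgebraic.isSepClosed`),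
so `κ(x) = κ(y)` (`IsSepClosed.algebraMap_surjective`).

* `quotient_surjective_of_isSepClosed` — ring form: `R → C` formally unramified of finite type, `R` of finite type over
  a separably closed field, `𝔔 ⊆ C` maximal over a maximal ideal ⇒ `R → C/𝔔` is onto;
* `stalkMap_residue_surjective_of_isSepClosed` — **`𝒪_{X, φ y} → κ(y)` is onto** for `φ : Y → X` étale, `X` locally
  of finite type over a separably closed `K`, `φ y` closed;
* **`hasResolution_of_isolated_quotient_charts_of_isSepClosed`** — `X` integral, locally of finite type over a
  separably closed `K`, finitely many singular points, each in the image of an étale quotient chart `Spec S₀ → X`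
  (`S` regular of finite type graded by ANY finite abelian group) ⇒ `Scheme.HasResolution X`;
* `hasResolution_of_quotient_surface_of_isSepClosed`, `stub_diagonalizableQuotientResolution_of_isSepClosed_of_finite`
  — the stub's `hq` VERBATIM in dimension `≤ 2`, resp. with finite singular locus, over a separably closed field.

Honest label: one more slice of `stub_diagonalizableQuotientResolution` (isolated singularities, ground field separably
closed instead of algebraically closed); no stub closed by name; the residue-field-free E-k (arbitrary `K`) remains open
design (memo MEMO-15317-leafhand4-g2, G1–G3). No definitions, no named facts, no sorry.
[cite: StacksProject, Tag 02G7; Tag 00FZ; Tag 02GL] [cite: Kato1994, (10.4)] [folklore; cite: Kollar2007, §2.2]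
-/

noncomputable section

-- single-problem summit: the doubled namespace component is forced
set_option linter.dupNamespace false

open CategoryTheory AlgebraicGeometry TopologicalSpace
open Literature.AlgebraicGeometry.Resolution
open Summit.ResolutionOfSingularities.ResolutionOfSingularities.Theorems.FRationalResolution

namespace Summit.ResolutionOfSingularities.ResolutionOfSingularities.Theorems.FRationalResolution.IsolatedQuotientResolutionSepClosed

/-- **Ring form: over a separably closed field, an unramified algebra has trivial residue extensions over closed
points.** Let `R` be of finite type over a separably closed field `K`, `R → C` formally unramified of finite type, and
`𝔔 ⊆ C` maximal lying over a maximal ideal `𝔭`. Then `R → C/𝔔` is onto: `C/𝔔` is separable over `R/𝔭`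
(`Algebra.FormallyUnramified.isSeparable`) and `R/𝔭`, being finite over `K` (Zariski's lemma), is separably closed.
[cite: StacksProject, Tag 02GL; Tag 00FZ] -/
theorem quotient_surjective_of_isSepClosed {K R C : Type} [Field K] [IsSepClosed K] [CommRing R] [CommRing C]
    [Algebra K R] [Algebra.FiniteType K R] [Algebra R C] [Algebra.FormallyUnramified R C] [Algebra.FiniteType R C]
    (𝔔 : Ideal C) [𝔔.IsMaximal] (h𝔭 : (𝔔.comap (algebraMap R C)).IsMaximal) :
    ∀ c : C, ∃ r : R, c - algebraMap R C r ∈ 𝔔 := by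
  set 𝔭 : Ideal R := 𝔔.comap (algebraMap R C) with h𝔭def
  haveI : 𝔭.IsMaximal := h𝔭
  haveI : 𝔔.LiesOver 𝔭 := ⟨rfl⟩
  letI : Field (R ⧸ 𝔭) := Ideal.Quotient.field 𝔭
  letI : Field (C ⧸ 𝔔) := Ideal.Quotient.field 𝔔
  -- `C/𝔔` is formally unramified of finite type over `R/𝔭`, hence separable
  haveI : Algebra.FormallyUnramified (R ⧸ 𝔭) (C ⧸ 𝔔) :=
    Algebra.FormallyUnramified.of_restrictScalars R (R ⧸ 𝔭) (C ⧸ 𝔔)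
  haveI : Algebra.FiniteType (R ⧸ 𝔭) (C ⧸ 𝔔) :=
    Algebra.FiniteType.of_restrictScalars_finiteType R (R ⧸ 𝔭) (C ⧸ 𝔔)
  haveI : Algebra.IsSeparable (R ⧸ 𝔭) (C ⧸ 𝔔) := Algebra.FormallyUnramified.isSeparable (R ⧸ 𝔭) (C ⧸ 𝔔)
  -- `R/𝔭` is finite over `K`, hence separably closed
  haveI : Module.Finite K (R ⧸ 𝔭) := finite_of_finite_type_of_isJacobsonRing K (R ⧸ 𝔭)
  haveI : IsSepClosed (R ⧸ 𝔭) := Algebra.IsAlgebraic.isSepClosed (F := K) (E := R ⧸ 𝔭)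
  have hsurj : Function.Surjective (algebraMap (R ⧸ 𝔭) (C ⧸ 𝔔)) :=
    IsSepClosed.algebraMap_surjective (R ⧸ 𝔭) (C ⧸ 𝔔)
  intro c
  obtain ⟨q, hq⟩ := hsurj (Ideal.Quotient.mk 𝔔 c)
  obtain ⟨r, rfl⟩ := Ideal.Quotient.mk_surjective q
  refine ⟨r, ?_⟩
  rw [← Ideal.Quotient.mk_eq_mk_iff_sub_mem, ← hq, Ideal.Quotient.algebraMap_mk_of_liesOver]

/-- **Over a separably closed field, `𝒪_{X,x} → κ(y)` is onto at every point `y ↦ x` of an étale chart over a closed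
point.** For `φ : Y → X` étale, `X` locally of finite type over a separably closed `K` and `φ y` closed: every germ
at `y` is congruent modulo `𝔪_y` to the pull-back of a germ at `φ y`. (On affine opens `V ↦ U`: `𝔮_y` is maximal
over the maximal `𝔭_x` by `…isMaximal_of_isMaximal_comap_of_formallyUnramified`, and `Γ(X, U) → Γ(Y, V)/𝔮_y` is
onto by `quotient_surjective_of_isSepClosed`.) [cite: StacksProject, Tag 02GL; Tag 00FZ] -/
theorem stalkMap_residue_surjective_of_isSepClosed {K : Type} [Field K] [IsSepClosed K] {X Y : Scheme.{0}}
    (f : X ⟶ Spec (.of K)) [LocallyOfFiniteType f] (φ : Y ⟶ X) [Etale φ] (y : Y)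
    (hx : IsClosed ({φ y} : Set X)) :
    ∀ c : Y.presheaf.stalk y, ∃ b : X.presheaf.stalk (φ y),
      c - (φ.stalkMap y).hom b ∈ IsLocalRing.maximalIdeal (Y.presheaf.stalk y) := by
  classical
  -- affine opens `U ∋ φ y`, `V ∋ y` with `V ⊆ φ⁻¹ U`
  obtain ⟨U, hU, hxU, -⟩ := exists_isAffineOpen_mem_and_subset (U := ⊤) (Set.mem_univ (φ y))
  obtain ⟨V, hV, hyV, hVU⟩ := exists_isAffineOpen_mem_and_subset (U := φ ⁻¹ᵁ U) (show y ∈ φ ⁻¹ᵁ U from hxU)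
  have e : V ≤ φ ⁻¹ᵁ U := hVU
  set 𝔭 := hU.primeIdealOf ⟨φ y, hxU⟩ with h𝔭def
  haveI h𝔭max : 𝔭.asIdeal.IsMaximal := hU.primeIdealOf_isMaximal_of_isClosed ⟨φ y, hxU⟩ hx
  -- the `K`-algebra `Γ(X, U)`, of finite type
  set ι := hU.fromSpec with hιdef
  obtain ⟨gk, hgk⟩ := Spec.map_surjective (ι ≫ f)
  letI : Algebra K Γ(X, U) := gk.hom.toAlgebra
  haveI : Algebra.FiniteType K Γ(X, U) := by
    have h1 : LocallyOfFiniteType (Spec.map gk) := by rw [hgk]; infer_instance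
    rw [HasRingHomProperty.Spec_iff (P := @LocallyOfFiniteType)] at h1
    exact h1
  -- the chart ring `Γ(Y, V)`, étale over `Γ(X, U)`
  set ψ := φ.appLE U V e with hψdef
  have hψ : ψ.hom.Etale := φ.etale_appLE hU hV e
  letI : Algebra Γ(X, U) Γ(Y, V) := ψ.hom.toAlgebra
  haveI : Algebra.Etale Γ(X, U) Γ(Y, V) := hψ
  set 𝔔 := hV.primeIdealOf ⟨y, hyV⟩ with h𝔔def
  have hcomap : 𝔔.asIdeal.comap (algebraMap Γ(X, U) Γ(Y, V)) = 𝔭.asIdeal := by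
    have h := hU.comap_primeIdealOf_appLE (f := φ) U V hV e hyV
    exact congrArg PrimeSpectrum.asIdeal h
  -- `𝔔` is maximal and `Γ(X, U) → Γ(Y, V)/𝔔` is onto
  haveI h𝔔max : 𝔔.asIdeal.IsMaximal :=
    EtaleChartPrimaryCentreAlgClosed.isMaximal_of_isMaximal_comap_of_formallyUnramified 𝔔.asIdeal
      (hcomap ▸ h𝔭max)
  have hsurj : ∀ c : Γ(Y, V), ∃ r : Γ(X, U), c - algebraMap Γ(X, U) Γ(Y, V) r ∈ 𝔔.asIdeal :=
    quotient_surjective_of_isSepClosed (K := K) 𝔔.asIdeal (hcomap ▸ h𝔭max)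
  -- read off the stalk
  intro c
  letI := X.presheaf.algebra_section_stalk ⟨φ y, hxU⟩
  haveI := hU.isLocalization_stalk ⟨φ y, hxU⟩
  letI := Y.presheaf.algebra_section_stalk ⟨y, hyV⟩
  haveI := hV.isLocalization_stalk ⟨y, hyV⟩
  obtain ⟨⟨c₁, s⟩, hcs⟩ := IsLocalization.surj 𝔔.asIdeal.primeCompl c
  obtain ⟨a₁, ha₁'⟩ := hsurj c₁
  obtain ⟨a₂, ha₂'⟩ := hsurj (s : Γ(Y, V))
  have ha₂𝔭 : a₂ ∉ 𝔭.asIdeal := by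
    intro h2
    rw [← hcomap, Ideal.mem_comap] at h2
    have : (s : Γ(Y, V)) ∈ 𝔔.asIdeal := by
      have h3 := 𝔔.asIdeal.add_mem ha₂' h2
      rwa [sub_add_cancel] at h3
    exact s.2 this
  -- the germs of `a₁`, `a₂` at `x`; `a₂` is a unit there
  set gx : Γ(X, U) → X.presheaf.stalk (φ y) := fun a => (X.presheaf.germ U (φ y) hxU).hom a with hgxdef
  have hu : IsUnit (gx a₂) :=
    IsLocalization.map_units (X.presheaf.stalk (φ y)) (⟨a₂, ha₂𝔭⟩ : 𝔭.asIdeal.primeCompl)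
  set θ : Γ(X, U) →+* Y.presheaf.stalk y :=
    (algebraMap Γ(Y, V) (Y.presheaf.stalk y)).comp (algebraMap Γ(X, U) Γ(Y, V)) with hθdef
  have hpull : ∀ a : Γ(X, U), (φ.stalkMap y).hom (gx a) = θ a := by
    intro a
    rw [hgxdef, ← EtaleChartPrimaryCentre.germ_appLE_apply φ U V e y hyV]
    rfl
  refine ⟨gx a₁ * ↑hu.unit⁻¹, ?_⟩
  have hinv : (φ.stalkMap y).hom ↑hu.unit⁻¹ * θ a₂ = 1 := by
    rw [← hpull a₂, ← map_mul, hu.val_inv_mul, map_one]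
  -- compute in the residue field
  set r := IsLocalRing.residue (Y.presheaf.stalk y) with hrdef
  rw [← IsLocalRing.residue_eq_zero_iff, map_sub, map_mul, hpull a₁]
  have h1 : r (algebraMap Γ(Y, V) (Y.presheaf.stalk y) c₁) = r (θ a₁) := by
    rw [← sub_eq_zero, ← map_sub, IsLocalRing.residue_eq_zero_iff]
    have := (IsLocalization.AtPrime.to_map_mem_maximal_iff (Y.presheaf.stalk y) 𝔔.asIdeal _).mpr ha₁'
    rwa [map_sub] at this
  have h2 : r (algebraMap Γ(Y, V) (Y.presheaf.stalk y) (s : Γ(Y, V))) = r (θ a₂) := by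
    rw [← sub_eq_zero, ← map_sub, IsLocalRing.residue_eq_zero_iff]
    have := (IsLocalization.AtPrime.to_map_mem_maximal_iff (Y.presheaf.stalk y) 𝔔.asIdeal _).mpr ha₂'
    rwa [map_sub] at this
  have hθ2 : r (θ a₂) ≠ 0 := by
    rw [← h2, Ne, IsLocalRing.residue_eq_zero_iff,
      IsLocalization.AtPrime.to_map_mem_maximal_iff (Y.presheaf.stalk y) 𝔔.asIdeal]
    exact s.2
  have hc : r c * r (θ a₂) = r (θ a₁) := by
    rw [← h2, ← map_mul, hcs, h1]
  have hinv' : r ((φ.stalkMap y).hom ↑hu.unit⁻¹) * r (θ a₂) = 1 := by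
    rw [← map_mul, hinv, map_one]
  have hc' : r c = r (θ a₁) * r ((φ.stalkMap y).hom ↑hu.unit⁻¹) := by
    have hi : r ((φ.stalkMap y).hom ↑hu.unit⁻¹) = (r (θ a₂))⁻¹ := eq_inv_of_mul_eq_one_left hinv'
    rw [hi, ← div_eq_mul_inv, eq_div_iff hθ2, hc]
  rw [hc', map_mul, sub_self]

/-- **ISOLATED diagonalizable quotient singularities over a SEPARABLY CLOSED field are resolvable (tame or wild, any
dimension).** Let `X` be integral, locally of finite type over a separably closed field `K`, with finitely many singular
points, each in the image of an étale morphism `Spec S₀ → X` where `S` is a REGULAR `K`-algebra of finite type graded by a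
finite abelian group `A` (no restriction on `|A|`) and `S₀ = 𝒮 0`. Then `X` has a resolution of singularities: the
singular points are closed (`…IsolatedClosed`), so E-k's residue condition holds at the chart points
(`stalkMap_residue_surjective_of_isSepClosed`) and `…IsolatedQuotientResolutionField.hasResolution_of_isolated_quotient_charts`
applies. [cite: Kato1994, (10.4)] [cite: Kollar2007, §2.2] [folklore; cite: SGA3, Exp. VIII §4–5] -/
theorem hasResolution_of_isolated_quotient_charts_of_isSepClosed (K : Type) [Field K] [IsSepClosed K]
    (X : Scheme.{0}) [IsIntegral X] (f : X ⟶ Spec (.of K)) [LocallyOfFiniteType f]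
    (hfin : (Scheme.regularLocus X)ᶜ.Finite)
    (hq : ∀ x : X, x ∉ Scheme.regularLocus X →
      ∃ (A : Type) (_ : AddCommGroup A) (_ : Finite A) (_ : DecidableEq A)
        (S : Type) (_ : CommRing S) (_ : Algebra K S) (𝒮 : A → Submodule K S)
        (_ : GradedAlgebra 𝒮), Algebra.FiniteType K S ∧ IsRegularRing S ∧
        ∃ φ : Spec (.of (𝒮 0)) ⟶ X, Etale φ ∧ x ∈ Set.range φ) :
    Scheme.HasResolution X := by
  refine IsolatedQuotientResolutionField.hasResolution_of_isolated_quotient_charts K X f hfin fun x hx => ?_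
  obtain ⟨A, iA, fA, dA, S, iS, aS, 𝒮, gS, hft, hregS, φ, hφ, ⟨v, hv⟩⟩ := hq x hx
  haveI := hφ
  have hcl : IsClosed ({φ v} : Set X) := by
    rw [hv]
    exact IsolatedClosed.isClosed_singleton_of_finite_singularLocus K X f hfin hx
  exact ⟨A, iA, fA, dA, S, iS, aS, 𝒮, gS, hft, hregS, φ, hφ, v, hv,
    stalkMap_residue_surjective_of_isSepClosed f φ v hcl⟩

/-- **Diagonalizable quotient SURFACE singularities over a separably closed field are resolvable** — the stub's `hq`
VERBATIM (tame or wild), `dim X ≤ 2`: the singular locus is finite (`…DiagQuotientSurface`), then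
`hasResolution_of_isolated_quotient_charts_of_isSepClosed`. [cite: Kato1994, (10.4)] [cite: Lipman1978, §2] -/
theorem hasResolution_of_quotient_surface_of_isSepClosed (K : Type) [Field K] [IsSepClosed K]
    (X : Scheme.{0}) (g : X ⟶ Spec (.of K)) [IsIntegral X] [LocallyOfFiniteType g] [QuasiCompact g]
    (hq : ∀ x : X, ∃ (A : Type) (_ : AddCommGroup A) (_ : Finite A) (_ : DecidableEq A)
        (S : Type) (_ : CommRing S) (_ : Algebra K S) (𝒮 : A → Submodule K S)
        (_ : GradedAlgebra 𝒮), Algebra.FiniteType K S ∧ IsRegularRing S ∧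
        ∃ φ : Spec (.of (𝒮 0)) ⟶ X, Etale φ ∧ x ∈ Set.range φ ∧
          φ ≫ g = Spec.map (CommRingCat.ofHom (algebraMap K (𝒮 0))))
    (hdim : topologicalKrullDim X ≤ 2) :
    Scheme.HasResolution X := by
  obtain ⟨hfin, -⟩ := DiagQuotientSurface.diagQuotient_surface_singularLocus K X g hq hdim
  refine hasResolution_of_isolated_quotient_charts_of_isSepClosed K X g hfin fun x _ => ?_
  obtain ⟨A, iA, fA, dA, S, iS, aS, 𝒮, gS, hft, hreg, φ, hφ, hx, -⟩ := hq x
  exact ⟨A, iA, fA, dA, S, iS, aS, 𝒮, gS, hft, hreg, φ, hφ, hx⟩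

/-- **`stub_diagonalizableQuotientResolution` over a separably closed field when the singular locus is finite**
(binders of the stub verbatim, plus `IsSepClosed k` and `(Reg X)ᶜ` finite). [cite: Kato1994, (10.4)]
[cite: Kollar2007, §2.2] -/
theorem stub_diagonalizableQuotientResolution_of_isSepClosed_of_finite (k : Type) [Field k] [IsSepClosed k]
    (X : Scheme.{0}) (g : X ⟶ Spec (.of k)) [IsIntegral X] [IsSeparated g] [LocallyOfFiniteType g] [QuasiCompact g]
    (hq : ∀ x : X, ∃ (A : Type) (_ : AddCommGroup A) (_ : Finite A) (_ : DecidableEq A)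
        (S : Type) (_ : CommRing S) (_ : Algebra k S) (𝒮 : A → Submodule k S)
        (_ : GradedAlgebra 𝒮), Algebra.FiniteType k S ∧ IsRegularRing S ∧
        ∃ φ : Spec (.of (𝒮 0)) ⟶ X, Etale φ ∧ x ∈ Set.range φ ∧
          φ ≫ g = Spec.map (CommRingCat.ofHom (algebraMap k (𝒮 0))))
    (hfin : (Scheme.regularLocus X)ᶜ.Finite) :
    Scheme.HasResolution X := by
  refine hasResolution_of_isolated_quotient_charts_of_isSepClosed k X g hfin fun x _ => ?_
  obtain ⟨A, iA, fA, dA, S, iS, aS, 𝒮, gS, hft, hreg, φ, hφ, hx, -⟩ := hq x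
  exact ⟨A, iA, fA, dA, S, iS, aS, 𝒮, gS, hft, hreg, φ, hφ, hx⟩

end Summit.ResolutionOfSingularities.ResolutionOfSingularities.Theorems.FRationalResolution.IsolatedQuotientResolutionSepClosed

end
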